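import Literature.LinearAlgebra.Matrix.PermanentBooleanSum
import HarnessLib

/-!
# Absorbing a Boolean sum into a permanent: all variables at once

Continuation of `PermanentBooleanSum.lean` (the two-site gadget `permanent_boolSumGlue`:
`per (boolSumGlue A …) = 2 · (per A + per (A + ε₁E₁ + ε₂E₂))`). Here the gadget is applied to
every Boolean variable of a matrix `A(b) = A + ∑_k [b_k] (ε_k E_{u_k v_k} + ε'_k E_{u'_k v'_k})`
whose variables occupy two sites each (`SitePair`: distinct rows, distinct columns):

* `Matrix.extendAlong e A` — a square matrix pushed forward along an embedding of index
  types (`A` on the image, `0` elsewhere); its bookkeeping (`_apply_image`, `_add`, `_single`,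
  `_trans_inl`). A deliberate dot-notation extension of Mathlib's `Matrix` namespace (it takes
  a matrix argument), like `Matrix.subperm` in `PermanentSubperm.lean`.
* `Literature.LinearAlgebra.Matrix.SitePair`, `boolPoint A l b` (`= A(b)`), `boolPoint_cons`,
  `sum_boolPoint_cons` (splitting the Boolean sum on the head variable).
* `exists_boolSumScheme` — **the gluing scheme**: for a list `l` of site pairs with
  coefficients in a set `P ∋ 0, 1, -1` there are an index type `κ`, `#κ = #ι + 4|l|`, an
  embedding `e : ι ↪ κ` and a constant matrix `C` (entries in `P`, zero on the image block)
  with `per (C + extendAlong e A) = 2^{|l|} ∑_{b ∈ {0,1}^{|l|}} per A(b)` for EVERY `A`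
  (induction on `l`: one gadget per variable; the universally quantified `A` carries the
  not-yet-glued sites through the induction).
* `exists_permanent_eq_two_pow_mul_boolSum` — the same as an honest `N × N` matrix with
  entries in `P` (reindex `κ ≃ Fin N`).

This is the division-free, multiplicity-two form of Bürgisser–Clausen–Shokrollahi 1997,
Thm. (21.29) ("a matrix `A'` of size `≤ 10N` with `per A' = ∑_e per A(X, e)`", there over a
field of characteristic `≠ 2` and for the column-unique matrices of (21.27)): here over any
commutative ring, with the factor `2^t` in place of the division by it, size `N + 4t`, for
matrices in which every Boolean variable has exactly two sites.

## References

* P. Bürgisser, M. Clausen, M. A. Shokrollahi, *Algebraic Complexity Theory*, Springer 1997,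
  Thm. (21.29).
* P. Bürgisser, *On defining integers and proving arithmetic circuit lower bounds*, Comput.
  Complexity 18 (2009), proof of Thm. 2.10.
-/

namespace Matrix

open Equiv Finset

universe u v

variable {ι : Type u} {κ : Type v} {R : Type*}

open scoped Classical in
/-- Extension of a square matrix along an embedding of index types: `A` on the image of `e`,
`0` elsewhere (classical case distinction on membership in the image). [folklore] -/
noncomputable def extendAlong [Zero R] (e : ι ↪ κ) (A : Matrix ι ι R) : Matrix κ κ R :=
  of fun x y => if h : (∃ i, e i = x) ∧ (∃ j, e j = y) then A h.1.choose h.2.choose else 0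

/-- On the image the extension is the matrix. [folklore] -/
@[simp] theorem extendAlong_apply_image [Zero R] (e : ι ↪ κ) (A : Matrix ι ι R) (i j : ι) :
    extendAlong e A (e i) (e j) = A i j := by
  have h : (∃ i', e i' = e i) ∧ (∃ j', e j' = e j) := ⟨⟨i, rfl⟩, ⟨j, rfl⟩⟩
  simp only [extendAlong, of_apply]
  rw [dif_pos h, e.injective h.1.choose_spec, e.injective h.2.choose_spec]

/-- Off the image (rows) the extension vanishes. [folklore] -/
theorem extendAlong_apply_of_row [Zero R] (e : ι ↪ κ) (A : Matrix ι ι R) {x : κ} (y : κ)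
    (hx : ∀ i, e i ≠ x) : extendAlong e A x y = 0 := by
  simp only [extendAlong, of_apply]
  rw [dif_neg]
  rintro ⟨⟨i, hi⟩, -⟩
  exact hx i hi

/-- Off the image (columns) the extension vanishes. [folklore] -/
theorem extendAlong_apply_of_col [Zero R] (e : ι ↪ κ) (A : Matrix ι ι R) (x : κ) {y : κ}
    (hy : ∀ j, e j ≠ y) : extendAlong e A x y = 0 := by
  simp only [extendAlong, of_apply]
  rw [dif_neg]
  rintro ⟨-, ⟨j, hj⟩⟩
  exact hy j hj

/-- Extension along the identity. [folklore] -/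
@[simp] theorem extendAlong_refl [Zero R] (A : Matrix ι ι R) :
    extendAlong (Function.Embedding.refl ι) A = A := by
  ext i j
  exact extendAlong_apply_image (Function.Embedding.refl ι) A i j

/-- Extension is additive. [folklore] -/
theorem extendAlong_add [AddZeroClass R] (e : ι ↪ κ) (A B : Matrix ι ι R) :
    extendAlong e (A + B) = extendAlong e A + extendAlong e B := by
  ext x y
  simp only [extendAlong, of_apply, add_apply]
  split_ifs <;> simp

/-- Extension of a single-entry matrix. [folklore] -/
theorem extendAlong_single [DecidableEq ι] [DecidableEq κ] [Zero R] (e : ι ↪ κ) (u v : ι) (ε : R) :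
    extendAlong e (single u v ε) = single (e u) (e v) ε := by
  ext x y
  by_cases hx : ∃ i, e i = x
  · obtain ⟨i, rfl⟩ := hx
    by_cases hy : ∃ j, e j = y
    · obtain ⟨j, rfl⟩ := hy
      rw [extendAlong_apply_image]
      by_cases h : u = i ∧ v = j
      · obtain ⟨rfl, rfl⟩ := h
        simp
      · have h' : ¬ (e u = e i ∧ e v = e j) := fun hh => h ⟨e.injective hh.1, e.injective hh.2⟩
        rw [single_apply, if_neg h, single_apply, if_neg h']
    · rw [extendAlong_apply_of_col e _ _ (fun j hj => hy ⟨j, hj⟩),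
        single_apply_of_col_ne _ _ (fun h => hy ⟨v, h⟩)]
  · rw [extendAlong_apply_of_row e _ _ (fun i hi => hx ⟨i, hi⟩),
      single_apply_of_row_ne (fun h => hx ⟨u, h⟩)]

/-- Extending along `e` and then into the first summand is the block matrix `(extend 0; 0 0)`. [folklore] -/
theorem extendAlong_trans_inl [Zero R] {γ : Type*} (e : ι ↪ κ) (A : Matrix ι ι R) :
    extendAlong (e.trans ⟨Sum.inl, Sum.inl_injective⟩) A =
      fromBlocks (extendAlong e A) 0 0 (0 : Matrix γ γ R) := by
  ext x y
  rcases x with x | g <;> rcases y with y | g'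
  · simp only [fromBlocks_apply₁₁]
    by_cases hx : ∃ i, e i = x
    · obtain ⟨i, rfl⟩ := hx
      by_cases hy : ∃ j, e j = y
      · obtain ⟨j, rfl⟩ := hy
        rw [extendAlong_apply_image]
        exact extendAlong_apply_image (e.trans ⟨Sum.inl, Sum.inl_injective⟩) A i j
      · rw [extendAlong_apply_of_col _ _ _ (fun j hj => hy ⟨j, Sum.inl_injective hj⟩),
          extendAlong_apply_of_col _ _ _ (fun j hj => hy ⟨j, hj⟩)]
    · rw [extendAlong_apply_of_row _ _ _ (fun i hi => hx ⟨i, Sum.inl_injective hi⟩),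
        extendAlong_apply_of_row _ _ _ (fun i hi => hx ⟨i, hi⟩)]
  · rw [fromBlocks_apply₁₂, extendAlong_apply_of_col _ _ _ (fun j hj => Sum.inl_ne_inr hj)]
    rfl
  · rw [fromBlocks_apply₂₁, extendAlong_apply_of_row _ _ _ (fun i hi => Sum.inl_ne_inr hi)]
    rfl
  · rw [fromBlocks_apply₂₂, extendAlong_apply_of_row _ _ _ (fun i hi => Sum.inl_ne_inr hi)]
    rfl

end Matrix

namespace Literature.LinearAlgebra.Matrix

open _root_.Matrix Equiv Finset

universe u

variable {ι : Type u} [DecidableEq ι] {R : Type*} [CommRing R]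

/-- Gluing is additive in the first block: the ports and the core do not depend on `A`. [folklore] -/
theorem boolSumGlue_add (A X : Matrix ι ι R) (u₁ v₁ u₂ v₂ : ι) (ε₁ ε₂ : R) :
    boolSumGlue (A + X) u₁ v₁ u₂ v₂ ε₁ ε₂ =
      boolSumGlue A u₁ v₁ u₂ v₂ ε₁ ε₂ + fromBlocks X 0 0 (0 : Matrix (Fin 4) (Fin 4) R) := by
  ext x y
  rcases x with x | g <;> rcases y with y | g' <;> simp [boolSumGlue, fromBlocks]

/-- **A Boolean variable with two sites**: rows `u₁ ≠ u₂`, columns `v₁ ≠ v₂`, coefficients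
`ε₁, ε₂`; the variable `y` contributes `y · (ε₁ E_{u₁v₁} + ε₂ E_{u₂v₂})` to the matrix. [folklore] -/
structure SitePair (ι : Type u) (R : Type*) where
  /-- row of the first site -/
  u₁ : ι
  /-- column of the first site -/
  v₁ : ι
  /-- row of the second site -/
  u₂ : ι
  /-- column of the second site -/
  v₂ : ι
  /-- coefficient of the first site -/
  ε₁ : R
  /-- coefficient of the second site -/
  ε₂ : R
  /-- the rows are distinct -/
  hu : u₁ ≠ u₂
  /-- the columns are distinct -/
  hv : v₁ ≠ v₂

/-- The matrix `ε₁ E_{u₁v₁} + ε₂ E_{u₂v₂}` of a site pair. [folklore] -/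
def SitePair.toMatrix (s : SitePair ι R) : Matrix ι ι R :=
  single s.u₁ s.v₁ s.ε₁ + single s.u₂ s.v₂ s.ε₂

/-- The matrix `A(b) = A + ∑_k [b_k] (ε E + ε' E')_k` at a Boolean point `b` of a list of site
pairs. [folklore] -/
def boolPoint (A : Matrix ι ι R) (l : List (SitePair ι R)) (b : Fin l.length → Bool) : Matrix ι ι R :=
  A + ∑ k, if b k then (l.get k).toMatrix else 0

/-- `A(b)` for the empty list is `A`. [folklore] -/
theorem boolPoint_nil (A : Matrix ι ι R) (b : Fin 0 → Bool) : boolPoint A [] b = A := by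
  simp [boolPoint]

/-- `A(b)` for `s :: l`: the head variable contributes `[b 0] · s`, the tail is `A(b ∘ succ)` for `l`. [folklore] -/
theorem boolPoint_cons (A : Matrix ι ι R) (s : SitePair ι R) (l : List (SitePair ι R))
    (b : Fin (l.length + 1) → Bool) :
    boolPoint A (s :: l) b =
      boolPoint (A + if b 0 then s.toMatrix else 0) l (fun k => b k.succ) := by
  simp [boolPoint, Fin.sum_univ_succ, add_assoc]

/-- Splitting a sum over Boolean points on the head variable. [folklore] -/
theorem sum_boolPoint_cons {M : Type*} [AddCommMonoid M] (A : Matrix ι ι R) (s : SitePair ι R)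
    (l : List (SitePair ι R)) (F : Matrix ι ι R → M) :
    ∑ b : Fin (s :: l).length → Bool, F (boolPoint A (s :: l) b) =
      ∑ b : Fin l.length → Bool, F (boolPoint (A + s.toMatrix) l b) +
        ∑ b : Fin l.length → Bool, F (boolPoint A l b) := by
  show ∑ b : Fin (l.length + 1) → Bool, F (boolPoint A (s :: l) b) = _
  rw [← Fintype.sum_equiv (Fin.consEquiv fun _ => Bool) _ _ (fun _ => rfl),
    Fintype.sum_prod_type, Fintype.sum_bool]
  simp only [Fin.consEquiv_apply, boolPoint_cons, Fin.cons_zero, Fin.cons_succ]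
  simp

/-- **Gluing scheme for a list of two-site Boolean variables.** For every list `l` of site
pairs with coefficients in a set `P ∋ 0, 1, -1` there are an index type `κ` with
`#κ = #ι + 4 |l|`, an embedding `e : ι ↪ κ` and a matrix `C` of constants from `P` vanishing on
the image block, such that for EVERY `A`,
`per (C + extendAlong e A) = 2^{|l|} · ∑_{b ∈ {0,1}^{|l|}} per A(b)`:
glue one gadget per variable (`permanent_boolSumGlue`), the later gadgets seeing the earlier
ones as part of the constant matrix. [folklore] -/
theorem exists_boolSumScheme [Fintype ι] (P : R → Prop) (h0 : P 0) (h1 : P 1) (hn : P (-1)) :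
    ∀ l : List (SitePair ι R), (∀ s ∈ l, P s.ε₁ ∧ P s.ε₂) →
    ∃ (κ : Type u) (_ : Fintype κ) (_ : DecidableEq κ) (e : ι ↪ κ) (C : Matrix κ κ R),
      Fintype.card κ = Fintype.card ι + 4 * l.length ∧
      (∀ x y, P (C x y)) ∧ (∀ i j, C (e i) (e j) = 0) ∧
      ∀ A : Matrix ι ι R, (C + extendAlong e A).permanent =
        2 ^ l.length * ∑ b : Fin l.length → Bool, (boolPoint A l b).permanent
  | [], _ =>
    ⟨ι, inferInstance, inferInstance, Function.Embedding.refl ι, 0, by simp,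
      fun _ _ => by simpa using h0, fun _ _ => rfl, fun A => by simp [boolPoint]⟩
  | s :: l, hl => by
    obtain ⟨κ, _, _, e, C, hcard, hP, hC, hper⟩ :=
      exists_boolSumScheme P h0 h1 hn l (fun s' hs' => hl s' (List.mem_cons_of_mem _ hs'))
    have hs := hl s List.mem_cons_self
    refine ⟨κ ⊕ Fin 4, inferInstance, inferInstance, e.trans ⟨Sum.inl, Sum.inl_injective⟩,
      boolSumGlue C (e s.u₁) (e s.v₁) (e s.u₂) (e s.v₂) s.ε₁ s.ε₂, ?_, ?_, ?_, ?_⟩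
    · simp only [Fintype.card_sum, Fintype.card_fin, hcard, List.length_cons]
      ring
    · rintro (x | g) (y | g')
      · simpa using hP x y
      · simp only [boolSumGlue_inl_inr]
        split_ifs
        exacts [hs.1, hs.2, h0]
      · simp only [boolSumGlue_inr_inl]
        split_ifs
        exacts [h1, h1, h0]
      · simp only [boolSumGlue_inr_inr]
        fin_cases g <;> fin_cases g' <;> simp [boolSumCore, h0, h1, hn]
    · intro i j
      simpa using hC i j
    · intro A
      rw [extendAlong_trans_inl, ← boolSumGlue_add,
        permanent_boolSumGlue _ _ _ _ _ _ _ (e.injective.ne s.hu) (e.injective.ne s.hv)]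
      have hsum : C + extendAlong e A + single (e s.u₁) (e s.v₁) s.ε₁ + single (e s.u₂) (e s.v₂) s.ε₂ =
          C + extendAlong e (A + s.toMatrix) := by
        rw [extendAlong_add, SitePair.toMatrix, extendAlong_add, extendAlong_single, extendAlong_single]
        simp only [add_assoc]
      rw [hsum, hper A, hper (A + s.toMatrix), sum_boolPoint_cons, List.length_cons, pow_succ]
      ring

/-- **All variables at once, as an honest matrix.** For `A : ι × ι` with entries in `P` and a
list `l` of site pairs with coefficients in `P` (`0, ±1 ∈ P`), there is an `N × N` matrix
`B`, `N = #ι + 4|l|`, with entries in `P` and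
`per B = 2^{|l|} ∑_{b ∈ {0,1}^{|l|}} per (A + ∑_k [b_k] (ε E + ε' E')_k)`. [folklore] -/
theorem exists_permanent_eq_two_pow_mul_boolSum [Fintype ι] (P : R → Prop) (h0 : P 0) (h1 : P 1)
    (hn : P (-1)) (l : List (SitePair ι R)) (hl : ∀ s ∈ l, P s.ε₁ ∧ P s.ε₂) (A : Matrix ι ι R)
    (hA : ∀ i j, P (A i j)) :
    ∃ (N : ℕ) (B : Matrix (Fin N) (Fin N) R), N = Fintype.card ι + 4 * l.length ∧
      (∀ a b, P (B a b)) ∧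
      B.permanent = 2 ^ l.length * ∑ b : Fin l.length → Bool, (boolPoint A l b).permanent := by
  obtain ⟨κ, _, _, e, C, hcard, hP, hC, hper⟩ := exists_boolSumScheme P h0 h1 hn l hl
  let eq := Fintype.equivFin κ
  refine ⟨Fintype.card κ, (C + extendAlong e A).submatrix eq.symm eq.symm, hcard, ?_, ?_⟩
  · intro a b
    simp only [submatrix_apply, add_apply]
    set x := eq.symm a
    set y := eq.symm b
    by_cases hx : ∃ i, e i = x
    · obtain ⟨i, hi⟩ := hx
      by_cases hy : ∃ j, e j = y
      · obtain ⟨j, hj⟩ := hy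
        rw [← hi, ← hj, hC, extendAlong_apply_image, zero_add]
        exact hA i j
      · rw [extendAlong_apply_of_col _ _ _ (fun j hj => hy ⟨j, hj⟩), add_zero]
        exact hP _ _
    · rw [extendAlong_apply_of_row _ _ _ (fun i hi => hx ⟨i, hi⟩), add_zero]
      exact hP _ _
  · rw [permanent_submatrix_equiv, hper]

end Literature.LinearAlgebra.Matrix
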